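import Summits.HodgeConjecture.HodgeConjecture.Theses.EndoscopicMiddleDegree
import Literature.AlgebraicGeometry.HodgeTheory.HardLefschetzNFold
import Literature.AlgebraicGeometry.HodgeTheory.LefschetzOneOne
import Literature.AlgebraicTopology.SingularHomology.CupProductProofs

/-!
# `lefschetz-gysin-funnel` on crux `SectorComplement` (stmt-HodgeConjecture-14353) — NO-SKELETON
# certificate + salvage (crux-plan, generation 2)

THIS IS NOT A SKELETON: no `stub_*` is registered and no `SectorComplement_of` exists (and none can,
§1 and §4). It is the kernel-checked record of the crux-plan verdict `no-skeleton` for the idea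
`Cruxes/SectorComplement/Ideas/lefschetz-gysin-funnel.md` (≈ `special-divisor-staircase`), plus the
typed, proved SALVAGE of its lever for the route's tenure planner. Generation 1 of this unit
(planner-cruxplan-…-lefschetz-gysin-funn-0) checked an equivalent file (`funnel-salvage.lean`, item
evidence 2026-08-16T04:26:52Z, rc 0) whose tree mirror never landed (`crux write` rc 75 ×4) and whose
text is not materialisable on the hub; this file is an independent re-derivation (same documented
names where the gen-1 line card names them: `composition_iff`, `BallCell`, `KMZero`,
`SpecialDivisorBridge`, `exists_L_one_preimage`, `funnelStep`, `funnel`, `ladders_of_middleDegreeStep`,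
`cell_5_3/7_4/8_5`, `UpperBandFunnel`, `WiderStep`, `SectorComplementPrime`,
`sectorComplement_of_prime`, `prime_of_sectorComplement`, `prime_iff_hodgeConjecture`), extended by
§1 `residual_iff_sectorComplement`, §5 (mirror cells, vacuous cells) and §6 (cell numerology by
`decide`).

The crux (route `EndoscopicMiddleDegree`, DECLARED not-claimed sector frame, auto-cruxed 2026-08-16):
`SectorComplement : Prop := MiddleDegreeStep → _root_.HodgeConjecture`.

* §1 FRAME / COSTUME CERTIFICATE. `composition_iff S : (S → SectorComplement) ↔ (S ∧ MiddleDegreeStep →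
  HodgeConjecture)` — any would-be stub conjunction `S` with a composition `S → SectorComplement` proves
  the formal Hodge conjecture for EVERY smooth projective variety from the route's own target; and for
  any consequence `C` of the line (`MiddleDegreeStep → C`) the residual stub `MiddleDegreeStep → C → HC`
  is literally equivalent to the crux (`residual_iff_sectorComplement`): the mechanical meaning of
  COSTUME. (Re-derives Disproof.lean §1–§3 in three lines so that the certificate is self-contained;
  crux workfiles are not imported.)
* §2 THE LEVER, TYPED. `BallCell p k` (HC in degree `2k` on every `X` carrying a
  `UnitaryBallQuotientDatum p X`); `KMZero` and `SpecialDivisorBridge` VERBATIM from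
  `IdeatorTwoSketch.lean` (triage-vetted wording: Kudla–Millson's constant term puts a polarization in
  the span of the special divisors, BMM arXiv:1306.1515 p.36–37 Prop. 68 = Kudla–Millson, Publ. IHÉS 71
  (1990); bridge = projection formula + Fulton §19.1 + definition D1); `exists_L_one_preimage` (one
  Lefschetz step is ONTO rational Hodge classes above the middle — from the tree's bijective hard
  Lefschetz `HardLefschetzNFold.exists_hdg_preimage`, no semisimplicity needed); `funnelStep :
  BallCell (2l+i) (l+i) → BallCell (2l+i+1) (l+i+1)` and `funnel : BallCell (2l) l → ∀ i, BallCell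
  (2l+i) (l+i)` PROVED from `KMZero` + `SpecialDivisorBridge` (graded commutativity is DISCHARGED by
  the tree theorem `cupProduct_gradedComm_holds`, not carried as a hypothesis).
* §3 WHAT THE SECTOR DECIDES. `ladders_of_middleDegreeStep : MDS → BallCell 4 1 → BallCell 6 2 → KMZero
  → bridge → (∀ i, BallCell (4+i) (2+i)) ∧ (∀ i, BallCell (6+i) (3+i))`; new cells `cell_5_3`
  (unconditional modulo MDS at m = 1: `BallCell 4 1` is Lefschetz (1,1), `ballCell_one_of_lefschetzOneOne`),
  `cell_7_4`, `cell_8_5` (modulo MDS at m = 2 and BMM Cor. 2 at (6,2), conditional in print); the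
  ready-to-file Props `UpperBandFunnel`, `WiderStep` with proofs.
* §4 THE WOULD-BE SKELETON AND WHY IT IS REFUSED. The card's Transfer `C⁺` = `SectorComplementPrime :=
  MDS → ladders → HC`; `sectorComplement_of_prime` is what `SectorComplement_of` would have been
  (stubs: `BallCell 4 1`, `BallCell 6 2`, `KMZero`, `SpecialDivisorBridge`, `SectorComplementPrime`);
  `prime_iff_sectorComplement` (C⁺ is an EQUIVALENT form of the crux modulo the genuine stubs, not an
  easier one) and `prime_iff_hodgeConjecture` (handed its own HC-implied hypotheses, C⁺ IS the summit):
  the fifth stub is costume by rule, so the line is dead ON THIS CRUX.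
* §5 Hygiene: cells with `k > p` are vacuous (`ballCell_of_lt`); every upper cell is also implied by its
  mirror lower cell by hard Lefschetz alone (`ballCell_upper_of_lower`, the triage r1-3 remark); every
  cell is a sub-statement of the summit (`ballCell_of_hodgeConjecture`).
* §6 Numerology (`decide`): the open upper-band cells `p/2 < k < 2p/3`, `p ≤ 12`, are
  `(5,3),(7,4),(8,5),(9,5),(10,6),(11,6),(11,7),(12,7)`; exactly the first three funnel into the sector
  `{(4,2),(6,3)}` (base `(2(p−k), p−k)` with `p − k ∈ {2,3}`), the others into the middle cells
  `(8,4)`, `(10,5)` (m = 3, 4: outside `MiddleDegreeStep`'s `m ≤ 2`).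

Disproof used: `Disproof.lean` §1–§4 (`sectorComplement_iff_not_step_or_hc`, `hodgeConjecture_iff`,
`not_sectorComplement_iff`; no `_false_without_` theorem exists for this crux, `-- Targets: none`);
cycle-2 §5–§8 read from its evidence note (same truth table). No landed `Negative/` lemma exists for
this crux. Negatives index (2 entries, Fermat-K3 multisets / E-line matrices): unrelated shapes.
-/

set_option linter.dupNamespace false

noncomputable section

namespace Summit.HodgeConjecture.HodgeConjecture.Cruxes.SectorComplement.LefschetzGysinFunnel

open Literature.AlgebraicTopology.SingularHomology (cupProduct cupProduct_gradedComm_holds)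
open Literature.AlgebraicGeometry.HodgeTheory Literature.AlgebraicGeometry.Motives
open Literature.AlgebraicGeometry.ShimuraVarieties
open Summit.HodgeConjecture.HodgeConjecture.Theses.EndoscopicMiddleDegree

/-! ## §1 The frame and the costume certificate -/

/-- The crux, unfolded: `SectorComplement` IS `MiddleDegreeStep → HodgeConjecture`. [folklore] -/
theorem sectorComplement_iff :
    SectorComplement ↔ (MiddleDegreeStep → _root_.HodgeConjecture) :=
  Iff.rfl

/-- `HC ⇒ MiddleDegreeStep` (the datum records `IsSmoothProjective (2(m+1)) X`; conjunct 2 of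
`HodgeConjectureFor` at `p := m + 1`). [folklore] -/
theorem middleDegreeStep_of_hodgeConjecture (h : _root_.HodgeConjecture) : MiddleDegreeStep := by
  intro m X _ _ hD _ c hc hH
  obtain ⟨D⟩ := hD
  exact (h D.isSmoothProjective).2 (m + 1) c hc hH

/-- `HC ⇒ SectorComplement` (discard the hypothesis): the frame is a corollary of the summit. [folklore] -/
theorem sectorComplement_of_hodgeConjecture (h : _root_.HodgeConjecture) : SectorComplement :=
  fun _ ↦ h

/-- `HC ↔ MiddleDegreeStep ∧ SectorComplement`: the frame is exactly "HC minus the sector". [folklore] -/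
theorem hodgeConjecture_iff : _root_.HodgeConjecture ↔ MiddleDegreeStep ∧ SectorComplement :=
  ⟨fun h ↦ ⟨middleDegreeStep_of_hodgeConjecture h, sectorComplement_of_hodgeConjecture h⟩,
    fun h ↦ h.2 h.1⟩

/-- **COSTUME CERTIFICATE (composition form).** For every candidate stub conjunction `S`, a
composition `S → SectorComplement` is the same thing as a proof of the formal Hodge conjecture for ALL
smooth projective complex varieties from `S` and the route's own target `MiddleDegreeStep`. Read with
`S :=` the conjunction of the `stub_*` statements of a would-be `Lines/lefschetz-gysin-funnel.lean`.
[folklore] -/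
theorem composition_iff (S : Prop) :
    (S → SectorComplement) ↔ (S ∧ MiddleDegreeStep → _root_.HodgeConjecture) :=
  ⟨fun h hs ↦ h hs.1 hs.2, fun h hs hM ↦ h ⟨hs, hM⟩⟩

/-- … so, handed the stubs, the summit is EQUIVALENT to the route target. [folklore] -/
theorem summit_iff_target_of_composition {S : Prop} (h : S → SectorComplement) (hs : S) :
    _root_.HodgeConjecture ↔ MiddleDegreeStep :=
  ⟨middleDegreeStep_of_hodgeConjecture, h hs⟩

/-- The RESIDUAL STUB of a line whose honest output is a consequence `C` of the sector:
`MiddleDegreeStep → C → HodgeConjecture` ("HC off (sector ∪ C)"). -/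
def Residual (C : Prop) : Prop :=
  MiddleDegreeStep → C → _root_.HodgeConjecture

/-- **COSTUME CERTIFICATE (residual form).** If the line's genuine stubs give `MiddleDegreeStep → C`,
then its residual stub is LITERALLY EQUIVALENT to the crux — the mechanical definition of a costume
stub ("a stub restating the crux"). [folklore] -/
theorem residual_iff_sectorComplement {C : Prop} (hC : MiddleDegreeStep → C) :
    Residual C ↔ SectorComplement :=
  ⟨fun h hM ↦ h hM (hC hM), fun h hM _ ↦ h hM⟩

/-- … and, like the crux, the residual is a corollary of the summit (irrefutable short of `¬HC`). [folklore] -/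
theorem residual_of_hodgeConjecture (C : Prop) (h : _root_.HodgeConjecture) : Residual C :=
  fun _ _ ↦ h

/-- The composition every such line WOULD register: genuine stubs (`MDS → C`) + residual ⟹ crux.
(The H21 audit reports it `proof.conditional`, correctly: it credits nothing.) [folklore] -/
theorem sectorComplement_of_residual {C : Prop} (_hC : MiddleDegreeStep → C) (hR : Residual C) :
    SectorComplement :=
  fun hM ↦ hR hM (_hC hM)

/-! ## §2 The lever, typed: cells, Kudla–Millson's constant term, the special-divisor bridge, the funnel -/

/-- **The cell `(p, k)`**: the Hodge conjecture in degree `2k` for every `X` carrying a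
`UnitaryBallQuotientDatum p X` (compact arithmetic `p`-ball quotient of simple unitary type). Unbundled
so that it is VERBATIM the antecedent of `SpecialDivisorBridge` and the consequent of
`MiddleDegreeStep`. BMM Cor. 2 (arXiv:1306.1515 p.3) gives the cells `k ∉ ]p/3, 2p/3[` (conditionally
in print); the sector is `(4,2)`, `(6,3)` (the latter given `(6,2)`). [cite: arXiv:1306.1515, Cor. 2] -/
def BallCell (p k : ℕ) : Prop :=
  ∀ (X : SchemeOver ℂ), Nonempty (UnitaryBallQuotientDatum p X) →
    ∀ c : complexBetti X (2 * k), IsRationalClass c → IsOfHodgeType p X (2 * k) k k c →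
      c ∈ algebraicClasses X k

/-- Every cell is a sub-statement of the summit (the datum records `IsSmoothProjective p X`): cells are
honest pieces of the frame's conclusion, so refuting a cell refutes HC. [folklore] -/
theorem ballCell_of_hodgeConjecture (h : _root_.HodgeConjecture) (p k : ℕ) : BallCell p k := by
  rintro X ⟨D⟩ c hc hH
  exact (h D.isSmoothProjective).2 k c hc hH

/-- The sector at `m = 1`: `MiddleDegreeStep` turns `(4,1)` into `(4,2)`. [folklore] -/
theorem ballCell_four_two (hM : MiddleDegreeStep) (h41 : BallCell 4 1) : BallCell 4 2 :=
  fun X hD c hc hct ↦ hM 1 X le_rfl (by norm_num) hD (h41 X hD) c hc hct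

/-- The sector at `m = 2`: `MiddleDegreeStep` turns `(6,2)` (BMM Cor. 2, conditional in print: twisted
weighted fundamental lemma) into `(6,3)`. [cite: arXiv:1306.1515, Cor. 2] -/
theorem ballCell_six_three (hM : MiddleDegreeStep) (h62 : BallCell 6 2) : BallCell 6 3 :=
  fun X hD c hc hct ↦ hM 2 X (by norm_num) le_rfl hD (h62 X hD) c hc hct

/-- `(p, 1)` for every `p` is Lefschetz (1,1) (tree named fact `lefschetzOneOne_rational`); in
particular `BallCell 4 1`, the `m = 1` input of the sector, is a THEOREM. [cite: VoisinHodgeI2002, Thm. 11.30] -/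
theorem ballCell_one_of_lefschetzOneOne (h : lefschetzOneOne_rational) (p : ℕ) : BallCell p 1 := by
  rintro X ⟨D⟩ c hc hct
  exact h D.isSmoothProjective c hc hct

/-- **KM₀ (Kudla–Millson): a polarization of a compact arithmetic ball quotient lies in the span of
its special divisors** — VERBATIM `IdeatorTwo.KMZero` (triage r1-1/2/3: verified on the held text).
For `D : UnitaryBallQuotientDatum (p+1) S` there is hard-Lefschetz data `Λ` (for the polarization
`L^{⊗N}`, `K_S = (p+2)·c₁(L)` ample) whose hyperplane class is a finite sum of classes supported on
special divisors `D.specialSubvariety W`, `W` a totally positive LINE. In print: the class-valued theta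
series `[θ₁(g',φ)] = Σ_{β ≥ 0} [β,φ] W_β(g')` is a holomorphic modular form of weight `p+2 > 0` on
`U(1,1)` (BMM arXiv:1306.1515 p.37 Prop. 68 = Kudla–Millson 1990, main theorem), whose `β = 0`
coefficient is `[0,φ] = φ(0)·[Ω]`, `Ω` the Chern form of `K_S` (ibid. p.36, `[β,φ] :=
L^{q(n−t)}([β,φ]⁰)`); a linear form killing all `[Z(β,φ)]`, `β > 0`, but not `c₁(K_S)` would be a
non-zero CONSTANT holomorphic form of positive weight. UNPROVED in the tree (no class-valued theta
series object); size L. [cite: arXiv:1306.1515, p.36–37 Prop. 68] [cite: doi:10.1007/bf02699880, Thm. 2] -/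
def KMZero : Prop :=
  ∀ (p : ℕ) (S : SchemeOver ℂ) (D : UnitaryBallQuotientDatum (p + 1) S),
    ∃ (Λ : HardLefschetzNFold (p + 1) S) (n : ℕ) (W : Fin n → Submodule D.E (Fin (p + 1 + 1) → D.E))
      (d : Fin n → complexBetti S 2),
      (∀ i, IsTotallyPositive (conjRingHom D.E) D.H (W i) ∧ Module.finrank D.E (W i) = 1 ∧
        d i ∈ classesSupportedOn S (D.specialSubvariety (W i)) 2) ∧
      Λ.hyperplaneClass = ∑ i, d i

/-- **Special-divisor bridge** — VERBATIM `IdeatorTwo.SpecialDivisorBridge` (plumbing behind it: a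
class `d` supported on a special divisor of a datum-`(p+1)` variety is a combination of Gysin images
`ν_* 1` of datum-`p` ball quotients `ν : Z ⟶ S` normalising the components — images of `𝔹ᵖ ⊂ 𝔹ᵖ⁺¹`,
`W^⊥` anisotropic of the same signature type, `Stab_Γ W` torsion-free congruence — Fulton §19.1 for
"classes supported on a divisor = span of component classes", projection formula `ν_*(ν^* c ∪ 1) =
c ∪ ν_* 1` (tree `complexGysin_cup`, composed sorry-free in `IdeatorTwo.staircaseStep_holds`), `ν^*`
preserves rationality and type, `ν_*` preserves algebraic classes): HENCE HC in degree `2k` on all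
datum-`p` varieties makes `c ∪ d` algebraic for every rational Hodge `(k,k)`-class `c` on `S`. Blocked
in Lean on definition D1 (normalised special divisor as a `SchemeOver ℂ` with its own
`UnitaryBallQuotientDatum p` and the morphism `ν`; today `specialSubvariety W : Set S.left`); size M
after D1. [cite: arXiv:1306.1515, Part 2 §3.2–3.4] [cite: Fulton1998, §19.1] -/
def SpecialDivisorBridge : Prop :=
  ∀ (p k : ℕ) (S : SchemeOver ℂ) (D : UnitaryBallQuotientDatum (p + 1) S),
    (∀ (Z : SchemeOver ℂ), Nonempty (UnitaryBallQuotientDatum p Z) →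
        ∀ z : complexBetti Z (2 * k), IsRationalClass z → IsOfHodgeType p Z (2 * k) k k z →
          z ∈ algebraicClasses Z k) →
    ∀ (W : Submodule D.E (Fin (p + 1 + 1) → D.E)), IsTotallyPositive (conjRingHom D.E) D.H W →
      Module.finrank D.E W = 1 →
      ∀ d ∈ classesSupportedOn S (D.specialSubvariety W) 2,
        ∀ c : complexBetti S (2 * k), IsRationalClass c → IsOfHodgeType (p + 1) S (2 * k) k k c →
          cupProduct (show 2 * k + 2 = 2 * (k + 1) by omega) c d ∈ algebraicClasses S (k + 1)

/-- The bridge's antecedent IS the cell `(p, k)` (definitional). [folklore] -/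
theorem bridge_antecedent_iff (p k : ℕ) :
    (∀ (Z : SchemeOver ℂ), Nonempty (UnitaryBallQuotientDatum p Z) →
        ∀ z : complexBetti Z (2 * k), IsRationalClass z → IsOfHodgeType p Z (2 * k) k k z →
          z ∈ algebraicClasses Z k) ↔ BallCell p k :=
  Iff.rfl

/-- **One Lefschetz step is ONTO rational Hodge classes above the middle** (subtraction-free indexing:
dimension `2l+i+1`, degrees `2(l+i) → 2(l+i+1)`; every pair `k+1 ≤ n ≤ 2k+1` is `(l,i) = (n−k−1,
2k+1−n)`): a rational Hodge `(l+i+1, l+i+1)`-class is `h ∪ c'` for a rational Hodge `(l+i, l+i)`-class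
`c'`. From the tree's BIJECTIVE hard Lefschetz (`exists_hdg_preimage` at `2l + (i+1) = n`:
`c = L^{i+1} β`, `c' := L^i β`) — no semisimplicity / Deligne 8.2.8 needed (triage r1-2/3 sharpening).
[cite: VoisinHodgeI2002, Thm. 6.25, Rem. 6.27 and §7.1.2] -/
theorem exists_L_one_preimage {l i : ℕ} {X : SchemeOver ℂ} (Λ : HardLefschetzNFold (2 * l + i + 1) X)
    (c : complexBetti X (2 * (l + i + 1))) (hc : IsRationalClass c)
    (hct : IsOfHodgeType (2 * l + i + 1) X (2 * (l + i + 1)) (l + i + 1) (l + i + 1) c) :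
    ∃ c' : complexBetti X (2 * (l + i)), IsRationalClass c' ∧
      IsOfHodgeType (2 * l + i + 1) X (2 * (l + i)) (l + i) (l + i) c' ∧
      Λ.L 1 (2 * (l + i)) (2 * (l + i + 1)) (by omega) c' = c := by
  have e : l + (i + 1) = l + i + 1 := (Nat.add_assoc l i 1).symm
  have hct' : IsOfHodgeType (2 * l + i + 1) X (2 * (l + i + 1)) (l + (i + 1)) (l + (i + 1)) c := by
    rw [e]; exact hct
  obtain ⟨β, hβ, hβt, rfl⟩ :=
    Λ.exists_hdg_preimage (j := i + 1) (k := 2 * l) (by omega) (2 * (l + i + 1)) (by omega) l l c hc hct'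
  refine ⟨Λ.L i (2 * l) (2 * (l + i)) (by omega) β, Λ.isRationalClass_L _ _ _ _ hβ,
    Λ.isOfHodgeType_L _ _ _ _ l l hβt, ?_⟩
  dsimp only [HardLefschetzNFold.L]
  rw [lefschetzPowTo_succ_apply _ 0 (2 * (l + i)) (2 * (l + i)) (2 * (l + i + 1)) rfl (by omega)
      (by omega), lefschetzPowTo_zero_apply,
    lefschetzPowTo_succ_apply _ i (2 * l) (2 * (l + i)) (2 * (l + i + 1)) (by omega) (by omega)
      (by omega)]

/-- `h ∪ c` is algebraic for a rational Hodge `(k,k)`-class `c` on a datum-`(p+1)` variety once HC holds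
in degree `2k` on datum-`p` varieties: write `h = Σ dₜ` (KM₀) and apply the bridge termwise (graded
commutativity of the tree's cup product, `cupProduct_gradedComm_holds`, moves `dₜ` to the right).
[cite: arXiv:1306.1515, p.36–37 Prop. 68] [cite: Hatcher2002, Thm. 3.11] -/
theorem hyperplane_cup_mem (hbridge : SpecialDivisorBridge) {p k : ℕ} {S : SchemeOver ℂ}
    (D : UnitaryBallQuotientDatum (p + 1) S) (hA : BallCell p k)
    (Λ : HardLefschetzNFold (p + 1) S) {n : ℕ} (W : Fin n → Submodule D.E (Fin (p + 1 + 1) → D.E))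
    (d : Fin n → complexBetti S 2)
    (hd : ∀ i, IsTotallyPositive (conjRingHom D.E) D.H (W i) ∧ Module.finrank D.E (W i) = 1 ∧
        d i ∈ classesSupportedOn S (D.specialSubvariety (W i)) 2)
    (hsum : Λ.hyperplaneClass = ∑ i, d i)
    (c : complexBetti S (2 * k)) (hc : IsRationalClass c) (hct : IsOfHodgeType (p + 1) S (2 * k) k k c) :
    cupProduct (show 2 + 2 * k = 2 * (k + 1) by omega) Λ.hyperplaneClass c ∈
      algebraicClasses S (k + 1) := by
  rw [hsum, map_sum, LinearMap.sum_apply]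
  refine Submodule.sum_mem _ fun t _ ↦ ?_
  rw [cupProduct_gradedComm_holds ℂ (ComplexPoints S) (show 2 + 2 * k = 2 * (k + 1) by omega)
      (show 2 * k + 2 = 2 * (k + 1) by omega) (d t) c, pow_mul, neg_one_sq, one_pow, one_smul]
  exact hbridge p k S D hA (W t) (hd t).1 (hd t).2.1 (d t) (hd t).2.2 c hc hct

/-- **FUNNEL STEP**: the cell `(2l+i, l+i)` decides the cell `(2l+i+1, l+i+1)`, given KM₀ and the
bridge. Proof: a rational Hodge `(l+i+1,l+i+1)`-class on a datum-`(2l+i+1)` variety is `h ∪ c'`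
(`exists_L_one_preimage`), and `h ∪ c' = Σₜ dₜ ∪ c'` is algebraic by the bridge with input the cell
`(2l+i, l+i)` (`hyperplane_cup_mem`). [cite: arXiv:1306.1515, p.36–37 Prop. 68]
[cite: VoisinHodgeI2002, Thm. 6.25] -/
theorem funnelStep (hKM : KMZero) (hbridge : SpecialDivisorBridge) (l i : ℕ)
    (h : BallCell (2 * l + i) (l + i)) : BallCell (2 * l + i + 1) (l + i + 1) := by
  rintro X ⟨D⟩ c hc hct
  obtain ⟨Λ, n, W, d, hd, hsum⟩ := hKM (2 * l + i) X D
  obtain ⟨c', hc', hct', rfl⟩ := exists_L_one_preimage Λ c hc hct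
  dsimp only [HardLefschetzNFold.L]
  rw [lefschetzPowTo_succ_apply _ 0 (2 * (l + i)) (2 * (l + i)) (2 * (l + i + 1)) rfl (by omega)
      (by omega), lefschetzPowTo_zero_apply, Literature.Geometry.Kaehler.lefschetzOperator_apply]
  exact hyperplane_cup_mem hbridge D h Λ W d hd hsum c' hc' hct'

/-- **THE FUNNEL**: the MIDDLE cell `(2l, l)` decides every upper-band cell `(2l+i, l+i)` of the
odd/larger quotients, given KM₀ and the bridge (induction on `i`). This is the card's lever in general
form (triage r1-3 sharpening "state the general step"). [cite: arXiv:1306.1515, §1.2 and Prop. 68] -/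
theorem funnel (hKM : KMZero) (hbridge : SpecialDivisorBridge) (l : ℕ) (h0 : BallCell (2 * l) l) :
    ∀ i, BallCell (2 * l + i) (l + i)
  | 0 => h0
  | i + 1 => funnelStep hKM hbridge l i (funnel hKM hbridge l h0 i)

/-! ## §3 What the sector decides: the ladders `(4+i, 2+i)` and `(6+i, 3+i)` -/

/-- Granted KM₀ and the bridge, `MiddleDegreeStep` (with its two inputs `BallCell 4 1` = Lefschetz (1,1),
a theorem, and `BallCell 6 2` = BMM Cor. 2 at `(6,2)`, conditional in print) decides the two UPPER
LADDERS of cells based at the sector. [cite: arXiv:1306.1515, Cor. 2 and Prop. 68] -/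
theorem ladders_of_middleDegreeStep (hM : MiddleDegreeStep) (h41 : BallCell 4 1) (h62 : BallCell 6 2)
    (hKM : KMZero) (hbridge : SpecialDivisorBridge) :
    (∀ i, BallCell (2 * 2 + i) (2 + i)) ∧ (∀ i, BallCell (2 * 3 + i) (3 + i)) :=
  ⟨funnel hKM hbridge 2 (ballCell_four_two hM h41), funnel hKM hbridge 3 (ballCell_six_three hM h62)⟩

/-- New cell `(5,3)` — HC in codimension 3 on compact arithmetic 5-ball quotients (`3 ∈ ]5/3,10/3[`,
outside BMM Cor. 2; NOT the printed second range of BMM Thm. 1, which over-states — triage r1-1/3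
literature trap) — from the sector at `m = 1` (+ Lefschetz (1,1)), KM₀ and the bridge; no BMM(6,2)
needed. [cite: arXiv:1306.1515, Cor. 2] -/
theorem cell_5_3 (hM : MiddleDegreeStep) (h41 : BallCell 4 1) (hKM : KMZero)
    (hbridge : SpecialDivisorBridge) : BallCell 5 3 :=
  funnel hKM hbridge 2 (ballCell_four_two hM h41) 1

/-- New cell `(7,4)` (`4 ∈ ]7/3,14/3[`) from the sector at `m = 2` (+ BMM(6,2)). [cite: arXiv:1306.1515, Cor. 2] -/
theorem cell_7_4 (hM : MiddleDegreeStep) (h62 : BallCell 6 2) (hKM : KMZero)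
    (hbridge : SpecialDivisorBridge) : BallCell 7 4 :=
  funnel hKM hbridge 3 (ballCell_six_three hM h62) 1

/-- New cell `(8,5)` (`5 ∈ ]8/3,16/3[`), two funnel steps `(8,5) → (7,4) → (6,3)`. [cite: arXiv:1306.1515, Cor. 2] -/
theorem cell_8_5 (hM : MiddleDegreeStep) (h62 : BallCell 6 2) (hKM : KMZero)
    (hbridge : SpecialDivisorBridge) : BallCell 8 5 :=
  funnel hKM hbridge 3 (ballCell_six_three hM h62) 2

/-- READY-TO-FILE support statement (tenure): the middle cells decide all upper bands.
`KMZero → SpecialDivisorBridge → ∀ l, BallCell (2l) l → ∀ i, BallCell (2l+i) (l+i)`. -/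
def UpperBandFunnel : Prop :=
  KMZero → SpecialDivisorBridge → ∀ l, BallCell (2 * l) l → ∀ i, BallCell (2 * l + i) (l + i)

/-- `UpperBandFunnel` is PROVED (so file it only if the route wants the statement on record). [folklore] -/
theorem upperBandFunnel_holds : UpperBandFunnel :=
  fun hKM hbridge l h0 ↦ funnel hKM hbridge l h0

/-- READY-TO-FILE support/pay-off statement (triage r1-1's `WiderStep`): the sector + its two inputs +
KM₀ + bridge decide the three open cells `(5,3)`, `(7,4)`, `(8,5)`. -/
def WiderStep : Prop :=
  MiddleDegreeStep → BallCell 4 1 → BallCell 6 2 → KMZero → SpecialDivisorBridge →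
    BallCell 5 3 ∧ BallCell 7 4 ∧ BallCell 8 5

/-- `WiderStep` is PROVED. [folklore] -/
theorem widerStep_holds : WiderStep :=
  fun hM h41 h62 hKM hbridge ↦
    ⟨cell_5_3 hM h41 hKM hbridge, cell_7_4 hM h62 hKM hbridge, cell_8_5 hM h62 hKM hbridge⟩

/-! ## §4 The would-be skeleton and why it is refused (the card's Transfer `C⁺`) -/

/-- The card's Transfer `C⁺` = the RESIDUAL stub a concluding skeleton would need: HC off
(sector ∪ the two upper ladders). -/
def SectorComplementPrime : Prop :=
  MiddleDegreeStep → (∀ i, BallCell (2 * 2 + i) (2 + i)) → (∀ i, BallCell (2 * 3 + i) (3 + i)) →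
    _root_.HodgeConjecture

/-- What `SectorComplement_of` WOULD have been — stubs `BallCell 4 1` (theorem), `BallCell 6 2` (print,
conditional), `KMZero` (print, L), `SpecialDivisorBridge` (plumbing after D1, M) and the residual
`SectorComplementPrime` (COSTUME, below). Kernel-checked; deliberately NOT named `SectorComplement_of`
and NOT registered. [folklore] -/
theorem sectorComplement_of_prime (hP : SectorComplementPrime) (h41 : BallCell 4 1)
    (h62 : BallCell 6 2) (hKM : KMZero) (hbridge : SpecialDivisorBridge) : SectorComplement :=
  fun hM ↦ hP hM (ladders_of_middleDegreeStep hM h41 h62 hKM hbridge).1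
    (ladders_of_middleDegreeStep hM h41 h62 hKM hbridge).2

/-- Conversely the crux gives `C⁺` outright (discard the ladders). [folklore] -/
theorem prime_of_sectorComplement (h : SectorComplement) : SectorComplementPrime :=
  fun hM _ _ ↦ h hM

/-- So `C⁺` is an EQUIVALENT form of the crux modulo the genuine stubs — not an easier one. [folklore] -/
theorem prime_iff_sectorComplement (h41 : BallCell 4 1) (h62 : BallCell 6 2) (hKM : KMZero)
    (hbridge : SpecialDivisorBridge) : SectorComplementPrime ↔ SectorComplement :=
  ⟨fun hP ↦ sectorComplement_of_prime hP h41 h62 hKM hbridge, prime_of_sectorComplement⟩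

/-- `C⁺` is a corollary of HC … [folklore] -/
theorem prime_of_hodgeConjecture (h : _root_.HodgeConjecture) : SectorComplementPrime :=
  fun _ _ _ ↦ h

/-- … and handed its own (HC-implied) hypotheses, `C⁺` IS the summit: filing it as `stub_residual` would
seat a lead prover on the Hodge conjecture. This is the verdict `no-skeleton`. [folklore] -/
theorem prime_iff_hodgeConjecture (hM : MiddleDegreeStep) (h1 : ∀ i, BallCell (2 * 2 + i) (2 + i))
    (h2 : ∀ i, BallCell (2 * 3 + i) (3 + i)) : SectorComplementPrime ↔ _root_.HodgeConjecture :=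
  ⟨fun h ↦ h hM h1 h2, fun h _ _ _ ↦ h⟩

/-- `C⁺` is the `Residual` of §1 for `C :=` "the two ladders"; `residual_iff_sectorComplement` applies
with `hC := ladders_of_middleDegreeStep`. [folklore] -/
theorem prime_iff_residual :
    SectorComplementPrime ↔
      Residual ((∀ i, BallCell (2 * 2 + i) (2 + i)) ∧ (∀ i, BallCell (2 * 3 + i) (3 + i))) :=
  ⟨fun h hM hl ↦ h hM hl.1 hl.2, fun h hM h1 h2 ↦ h hM ⟨h1, h2⟩⟩

/-! ## §5 Hygiene: vacuous cells, mirror cells -/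

/-- Cells with `k > p` are vacuous: `H^{2k}` of a `p`-fold carries no non-zero `(k,k)`-class
(`IsOfHodgeType.eq_zero_pp_of_lt`). So the meaningful upper band is `p/2 < k ≤ p`. [folklore] -/
theorem ballCell_of_lt {p k : ℕ} (h : p < k) : BallCell p k := by
  rintro X - c - hct
  rw [hct.eq_zero_pp_of_lt h]
  exact Submodule.zero_mem _

/-- Every UPPER cell `(n, k)`, `n < 2k`, is also implied by its MIRROR lower cell `(n, n−k)` by hard
Lefschetz alone (tree `mem_algebraicClasses_of_lt_of_nonempty`; triage r1-3 remark) — e.g. `(5,3) ⟸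
(5,2)`. The funnel goes the other way round the middle: `(5,3) ⟸ (4,2)`. [cite: VoisinHodgeI2002, Thm. 6.25]
[cite: KerrPearlstein2011, §3.1] -/
theorem ballCell_upper_of_lower {n k : ℕ} (hHL : ∀ X, nonempty_hardLefschetzNFold n X) (hk : n < 2 * k)
    (h : BallCell n (n - k)) : BallCell n k := by
  rintro X ⟨D⟩ c hc hct
  exact mem_algebraicClasses_of_lt_of_nonempty (hHL X) D.isSmoothProjective hk (h X ⟨D⟩) c hc hct

/-! ## §6 Numerology (`decide`): which open upper-band cells the sector reaches -/

/-- The open upper-band cells `p/2 < k < 2p/3` with `p ≤ 12` (BMM Cor. 2 excludes exactly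
`]p/3, 2p/3[`; `k > p/2` is "above the middle"). [cite: arXiv:1306.1515, Cor. 2] -/
theorem upperBandCells_le_twelve :
    ((List.range 13).flatMap fun p ↦ (List.range 13).filter fun k ↦ p < 2 * k ∧ 3 * k < 2 * p).length = 8 ∧
    ((List.range 13).flatMap fun p ↦
        ((List.range 13).filter fun k ↦ p < 2 * k ∧ 3 * k < 2 * p).map fun k ↦ (p, k)) =
      [(5, 3), (7, 4), (8, 5), (9, 5), (10, 6), (11, 6), (11, 7), (12, 7)] := by
  decide

/-- Their funnel bases `(2(p−k), p−k)`: exactly `(5,3) ↦ (4,2)`, `(7,4) ↦ (6,3)`, `(8,5) ↦ (6,3)` land in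
the sector (`p − k ∈ {2,3}` = `MiddleDegreeStep`'s `m+1`, `m ∈ {1,2}`); the other five land on the middle
cells `(8,4)`, `(10,5)` (`m = 3, 4`). [folklore] -/
theorem funnelBases_le_twelve :
    ([(5, 3), (7, 4), (8, 5), (9, 5), (10, 6), (11, 6), (11, 7), (12, 7)].map
        fun c : ℕ × ℕ ↦ (2 * (c.1 - c.2), c.1 - c.2)) =
      [(4, 2), (6, 3), (6, 3), (8, 4), (8, 4), (10, 5), (8, 4), (10, 5)] := by
  decide

end Summit.HodgeConjecture.HodgeConjecture.Cruxes.SectorComplement.LefschetzGysinFunnel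

end
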